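import Summits.Schanuel.Schanuel.Theorems.RootDecomp1KTwoBaseCell05

/-!
# RootDecomp1KTwoBaseCell — lens 1, generation 36 «TWO-BASE WALL CELL of 33364» (RootDecomp1KTwoBaseCell.lean f6aad3c3…, 1847 l) — continuation (RootDecomp1KTwoBaseCell06): §6 first half — `coprime_psNumer`, `liouvilleNumber_sub_rat_lower_loglog`, `ℓ_b` is not log-log-Liouville

(lens-1 g36 `RootDecomp1KTwoBaseCell.lean`, sha256 f6aad3c3…cd39, own farm rc 0 · 0 sorry · axioms std; critic VERDICT STATUS L1729 PORT GO LOW;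
port by census-1 gen 15 in nine parts `RootDecomp1KTwoBaseCell01`–`09` — see the PORT NOTE of part 01; `--supports stmt-Schanuel-33364`; rung 0.)
-/

noncomputable section

open Complex IntermediateField Polynomial
open Summit.Schanuel.Schanuel.Theorems.RootDecomp1KHyper
open Summit.Schanuel.Schanuel.Theorems.RootDecomp1KHyper.HyperCell
open Summit.Schanuel.Schanuel.Theorems.RootDecomp1KGeneric
open Summit.Schanuel.Schanuel.Theorems.RootDecomp1KRelLiouvilleCell
open Summit.Schanuel.Schanuel.Theorems.RootDecomp1KLogLogCell (LogLogLiouville logLogLiouville_of_logSqLiouville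
  logLogLiouville_of_logHyperLiouville logLogLiouville_of_hyperLiouville)

namespace Summit.Schanuel.Schanuel.Theorems.RootDecomp1KTwoBaseCell

open LiouvilleNumber
open scoped Nat

/-- Upper bound for the tail in base `m ≥ 2`: `r_k ≤ 2·m^{-(k+1)!}`. -/
private theorem remainder_le {m : ℝ} (hm : 2 ≤ m) (k : ℕ) : remainder m k ≤ 2 / m ^ (k + 1)! := by
  have m1 : (1 : ℝ) < m := by linarith
  have m0 : (0 : ℝ) < m := by linarith
  have h := remainder_lt' k m1
  have hhalf : (1 : ℝ) / m ≤ 1 / 2 := one_div_le_one_div_of_le two_pos hm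
  have hpos : (0 : ℝ) < 1 - 1 / m := by linarith
  have hinv : (1 - 1 / m)⁻¹ ≤ 2 := by
    rw [inv_le_comm₀ hpos two_pos]
    linarith
  have hmk : (0 : ℝ) < 1 / m ^ (k + 1)! := by positivity
  calc remainder m k ≤ (1 - 1 / m)⁻¹ * (1 / m ^ (k + 1)!) := h.le
    _ ≤ 2 * (1 / m ^ (k + 1)!) := mul_le_mul_of_nonneg_right hinv hmk.le
    _ = 2 / m ^ (k + 1)! := by ring

/-! ## §6  Hypothesis-free certificates: the two-scale form bound for `(1, ℓ₂, ℓ₃)` and `ℓ_b` is not log-log-Liouville -/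

section FormBound
open LiouvilleNumber
open scoped Nat

/-- `2^K ≤ 2·K!`. -/
private theorem two_pow_le_two_mul_factorial (K : ℕ) : 2 ^ K ≤ 2 * K ! := by
  induction K with
  | zero => simp
  | succ n ih =>
    rcases Nat.eq_zero_or_pos n with h0 | hpos
    · subst h0; simp
    · rw [pow_succ, Nat.factorial_succ]
      calc 2 ^ n * 2 ≤ 2 * n ! * 2 := Nat.mul_le_mul_right _ ih
        _ = 2 * (2 * n !) := by ring
        _ ≤ 2 * ((n + 1) * n !) := by
            apply Nat.mul_le_mul_left; exact Nat.mul_le_mul_right _ (by omega)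

/-- The numerator of the `K`-th truncation in base `b`: `partialSum b K = psNumer b K / b^{K!}`. -/
def psNumer (b K : ℕ) : ℕ := ∑ i ∈ Finset.range (K + 1), b ^ (K.factorial - i.factorial)

/-- `partialSum b K = psNumer b K / b^{K!}`. -/
theorem partialSum_eq_psNumer_div {b : ℕ} (hb : 0 < b) (K : ℕ) :
    partialSum (b : ℝ) K = (psNumer b K : ℝ) / (b : ℝ) ^ K ! := by
  have hb0 : (b : ℝ) ≠ 0 := by exact_mod_cast hb.ne'
  unfold partialSum psNumer
  push_cast
  rw [Finset.sum_div]
  refine Finset.sum_congr rfl fun i hi => ?_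
  have hi' : i ! ≤ K ! := Nat.factorial_le (by have := Finset.mem_range.mp hi; omega)
  rw [pow_sub₀ _ hb0 hi']
  field_simp

/-- The numerator is `≡ 1 (mod b)` for `K ≥ 2`, hence prime to `b`: the truncation has EXACT denominator `b^{K!}`. -/
theorem coprime_psNumer (b : ℕ) {K : ℕ} (hK : 2 ≤ K) : Nat.Coprime (psNumer b K) b := by
  have hsplit : psNumer b K = b * (∑ i ∈ Finset.range K, b ^ (K.factorial - i.factorial - 1)) + 1 := by
    unfold psNumer
    rw [Finset.sum_range_succ, Nat.sub_self, pow_zero, Finset.mul_sum]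
    congr 1
    refine Finset.sum_congr rfl fun i hi => ?_
    have hi' := Finset.mem_range.mp hi
    have h1 : i.factorial ≤ (K - 1).factorial := Nat.factorial_le (by omega)
    have h2 : (K - 1).factorial < K.factorial := (Nat.factorial_lt (by omega)).mpr (by omega)
    obtain ⟨t, ht⟩ : ∃ t, K.factorial - i.factorial = t + 1 := ⟨K.factorial - i.factorial - 1, by omega⟩
    rw [ht, Nat.add_sub_cancel, pow_succ']
  rw [hsplit]
  exact (Nat.coprime_mul_left_add_left 1 b _).mpr (Nat.coprime_one_left b)

/-- `exp 4 ≤ 100`, `exp 1 ≤ 4`, `2 ≤ exp 1`, `6 ≤ exp 2` (decimal bounds on `e`). -/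
private theorem exp_four_le : Real.exp 4 ≤ 100 := by
  have h : Real.exp 4 = Real.exp 1 ^ 4 := by rw [← Real.exp_nat_mul]; norm_num
  rw [h]
  have h1 := Real.exp_one_lt_d9
  have h2 : Real.exp 1 ^ 4 ≤ (2.7182818286 : ℝ) ^ 4 :=
    pow_le_pow_left₀ (Real.exp_pos _).le h1.le 4
  exact h2.trans (by norm_num)

/-- `e ≤ 4`. -/
private theorem exp_one_le_four : Real.exp 1 ≤ 4 := by
  have := Real.exp_one_lt_d9; linarith

/-- `2 ≤ e`. -/
private theorem two_le_exp_one : (2 : ℝ) ≤ Real.exp 1 := by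
  have := Real.exp_one_gt_d9; linarith

/-- `6 ≤ e²`. -/
private theorem six_le_exp_two : (6 : ℝ) ≤ Real.exp 2 := by
  have h : Real.exp 2 = Real.exp 1 ^ 2 := by rw [← Real.exp_nat_mul]; norm_num
  rw [h]
  have h1 := Real.exp_one_gt_d9
  calc (6 : ℝ) ≤ (2.7182818283 : ℝ) ^ 2 := by norm_num
    _ ≤ Real.exp 1 ^ 2 := pow_le_pow_left₀ (by norm_num) h1.le 2

set_option maxHeartbeats 800000 in
/-- **Effective irrationality measure of `ℓ_b` at the LOG-LOG scale**: `|ℓ_b − p/q| ≥ exp(−8 · log q · log log q)`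
for `q ≥ max(b, 100)`. (With `b^{k!} ≤ q < b^{(k+1)!} = D`: `p/q` is NOT the truncation `P_{k+1}` — its exact
denominator is `D > q` by `coprime_psNumer` — so `|p/q − P_{k+1}| ≥ 1/(qD) ≥ q^{−(k+2)}` against a tail `≤ 1/(2qD)`;
and `2^k ≤ 2·k! ≤ 4 log q` gives `k + 2 ≤ 6 log log q`.) -/
theorem liouvilleNumber_sub_rat_lower_loglog {b : ℕ} (hb : 2 ≤ b) (r : ℚ) (hq : b ≤ r.den)
    (hq100 : 100 ≤ r.den) :
    Real.exp (-(8 * Real.log r.den * Real.log (Real.log r.den))) ≤ |liouvilleNumber b - r| := by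
  classical
  set q : ℕ := r.den with hqdef
  have hq2 : 2 ≤ q := hb.trans hq
  have hq0 : 0 < q := by omega
  have hq0R : (0 : ℝ) < q := by exact_mod_cast hq0
  have hq100R : (100 : ℝ) ≤ q := by exact_mod_cast hq100
  have hb1 : 1 < b := by omega
  have hb0 : 0 < b := by omega
  have hbR1 : (1 : ℝ) < b := by exact_mod_cast hb1
  have hbR2 : (2 : ℝ) ≤ b := by exact_mod_cast hb
  set L : ℝ := Real.log q with hLdef
  have hL4 : 4 ≤ L := (Real.le_log_iff_exp_le hq0R).mpr (exp_four_le.trans hq100R)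
  have hL0 : 0 < L := by linarith
  set LL : ℝ := Real.log L with hLLdef
  have hLL1 : 1 ≤ LL := (Real.le_log_iff_exp_le hL0).mpr (exp_one_le_four.trans hL4)
  have hqpow : ∀ n : ℕ, (q : ℝ) ^ n = Real.exp ((n : ℝ) * L) := fun n => by
    rw [Real.exp_nat_mul, hLdef, Real.exp_log hq0R]
  -- `k ≥ 1` with `b^{k!} ≤ q < b^{(k+1)!}`
  have hex : ∃ j : ℕ, q < b ^ (j + 1)! :=
    ⟨q, (Nat.lt_pow_self hb1).trans_le
      (Nat.pow_le_pow_right hb0 ((Nat.self_le_factorial _).trans (Nat.factorial_le (Nat.le_succ q))))⟩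
  set k : ℕ := Nat.find hex with hk
  have hkP : q < b ^ (k + 1)! := Nat.find_spec hex
  have hk1 : 1 ≤ k := by
    by_contra h0
    have h00 : k = 0 := by omega
    rw [h00] at hkP
    simp at hkP
    omega
  have hklow : b ^ k ! ≤ q := by
    have h := Nat.find_min hex (m := k - 1) (by omega)
    rw [Nat.sub_add_cancel hk1] at h
    exact not_lt.mp h
  -- `k + 2 ≤ 6 log log q`
  have hkLL : (k : ℝ) + 2 ≤ 6 * LL := by
    have h2 := Real.log_two_gt_d9
    have h2' := Real.log_two_lt_d9
    have hfacL : (k ! : ℝ) * Real.log 2 ≤ L := by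
      have h1 : (2 : ℝ) ^ k ! ≤ q := by
        have : ((2 : ℕ) ^ k ! : ℕ) ≤ q := (Nat.pow_le_pow_left hb _).trans hklow
        exact_mod_cast this
      have := Real.log_le_log (by positivity) h1
      rwa [Real.log_pow] at this
    have hfac : (k ! : ℝ) ≤ 2 * L := by nlinarith [Nat.cast_nonneg (α := ℝ) (k !)]
    have hpow : (2 : ℝ) ^ k ≤ 4 * L := by
      have h1 : ((2 ^ k : ℕ) : ℝ) ≤ ((2 * k ! : ℕ) : ℝ) := by exact_mod_cast two_pow_le_two_mul_factorial k
      push_cast at h1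
      linarith
    have hlog : (k : ℝ) * Real.log 2 ≤ 2 * Real.log 2 + LL := by
      have h1 := Real.log_le_log (by positivity) hpow
      rw [Real.log_pow, Real.log_mul (by norm_num) hL0.ne', show (4 : ℝ) = 2 ^ 2 by norm_num,
        Real.log_pow] at h1
      push_cast at h1
      linarith
    have hprod : LL * 0.6931471803 ≤ LL * Real.log 2 := mul_le_mul_of_nonneg_left h2.le (by linarith)
    have hka : ((k : ℝ) + 2) * Real.log 2 ≤ 6 * LL * Real.log 2 := by nlinarith
    exact le_of_mul_le_mul_right hka (by linarith)
  -- real quantities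
  set D : ℝ := (b : ℝ) ^ (k + 1)! with hD
  have hD0 : 0 < D := by positivity
  have hqD : (q : ℝ) < D := by rw [hD]; exact_mod_cast hkP
  have hDq : D ≤ (q : ℝ) ^ (k + 1) := by
    have e : D = ((b : ℝ) ^ k !) ^ (k + 1) := by
      rw [hD, ← pow_mul, Nat.factorial_succ, Nat.mul_comm]
    rw [e]
    exact pow_le_pow_left₀ (by positivity) (by exact_mod_cast hklow) _
  have hD' : (b : ℝ) ^ (k + 2)! = D ^ (k + 2) := by
    rw [hD, ← pow_mul, show k + 2 = (k + 1) + 1 by omega, Nat.factorial_succ (k + 1), Nat.mul_comm]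
  have hD4 : (4 : ℝ) ≤ D := by
    have h2' : 2 ≤ (k + 1)! := (show 2 ≤ k + 1 by omega).trans (Nat.self_le_factorial _)
    calc (4 : ℝ) = 2 ^ 2 := by norm_num
      _ ≤ (b : ℝ) ^ 2 := pow_le_pow_left₀ (by norm_num) hbR2 2
      _ ≤ (b : ℝ) ^ (k + 1)! := pow_le_pow_right₀ hbR1.le h2'
  -- the truncation `P = A / D` and the tail `R`
  set P : ℝ := partialSum b (k + 1) with hPdef
  set R : ℝ := remainder b (k + 1) with hRdef
  have hℓ : liouvilleNumber b = P + R := (partialSum_add_remainder hbR1 (k + 1)).symm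
  have hRpos : 0 < R := remainder_pos hbR1 (k + 1)
  have hRle : R ≤ 1 / (q * D) / 2 := by
    have h1 : R ≤ 2 / D ^ (k + 2) := by
      rw [← hD', show k + 2 = (k + 1) + 1 by omega]; exact remainder_le hbR2 (k + 1)
    have h3 : 2 / D ^ (k + 2) ≤ 2 / D ^ 3 := by
      gcongr
      · exact le_trans (by norm_num) hD4
      · omega
    have h4 : 2 / D ^ 3 ≤ 1 / (q * D) / 2 := by
      rw [div_div, div_le_div_iff₀ (by positivity) (by positivity), one_mul]
      have h5 : (q : ℝ) * D ≤ D * D := mul_le_mul_of_nonneg_right hqD.le hD0.le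
      have h6 : 4 * (D * D) ≤ D * (D * D) := mul_le_mul_of_nonneg_right hD4 (by positivity)
      nlinarith
    linarith
  have hPA : P = (psNumer b (k + 1) : ℝ) / D := by rw [hPdef, hD]; exact partialSum_eq_psNumer_div hb0 (k + 1)
  by_cases hrP : (r : ℝ) = P
  · -- `r` cannot BE the truncation: its exact denominator is `D > q`
    exfalso
    set A : ℕ := psNumer b (k + 1) with hA
    have hcop : Nat.Coprime (b ^ (k + 1)!) A :=
      (Nat.Coprime.pow_right ((k + 1)!) (coprime_psNumer b (by omega : 2 ≤ k + 1))).symm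
    have hrq : (r : ℝ) = (r.num : ℝ) / (q : ℝ) := by rw [hqdef]; exact_mod_cast r.num_div_den.symm
    have heq : (r.num : ℝ) * ((b ^ (k + 1)! : ℕ) : ℝ) = ((A : ℕ) : ℝ) * (q : ℝ) := by
      have h1 : (r.num : ℝ) / q = (A : ℝ) / D := by rw [← hrq, hrP, hPA]
      rw [div_eq_div_iff hq0R.ne' hD0.ne'] at h1
      rw [hD] at h1
      push_cast
      linarith
    have heqZ : (r.num : ℤ) * ((b ^ (k + 1)! : ℕ) : ℤ) = ((A : ℕ) : ℤ) * (q : ℤ) := by exact_mod_cast heq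
    have hdvd : b ^ (k + 1)! ∣ A * q := by
      have : ((b ^ (k + 1)! : ℕ) : ℤ) ∣ ((A * q : ℕ) : ℤ) := ⟨r.num, by push_cast at heqZ ⊢; linear_combination -heqZ⟩
      exact Int.natCast_dvd_natCast.mp this
    have hle : b ^ (k + 1)! ≤ q := Nat.le_of_dvd hq0 (hcop.dvd_of_dvd_mul_left hdvd)
    exact absurd hkP (not_lt.mpr hle)
  · -- `r ≠ P`: `|r − P| ≥ 1/(qD)`, the tail is at most half of that
    obtain ⟨p, hp⟩ := partialSum_eq_rat hb0 (k + 1)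
    rw [Nat.cast_pow] at hp
    set Nn : ℤ := r.num * (b : ℤ) ^ (k + 1)! - (p : ℤ) * q with hNn
    have hrq : (r : ℝ) = (r.num : ℝ) / q := by rw [hqdef]; exact_mod_cast r.num_div_den.symm
    have hdiff : (r : ℝ) - P = (Nn : ℝ) / (q * D) := by
      rw [hrq, hPdef, hp, hNn, hD]
      push_cast
      field_simp
    have hN0 : Nn ≠ 0 := by
      intro h0
      apply hrP
      have : (r : ℝ) - P = 0 := by rw [hdiff, h0]; simp
      linarith
    have hN1 : (1 : ℝ) ≤ |(Nn : ℝ)| := by exact_mod_cast Int.one_le_abs hN0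
    have hsep : 1 / (q * D) ≤ |(r : ℝ) - P| := by
      rw [hdiff, abs_div, abs_of_pos (by positivity : (0 : ℝ) < q * D)]
      exact div_le_div_of_nonneg_right hN1 (by positivity)
    have htri : |(r : ℝ) - P| - R ≤ |liouvilleNumber b - r| := by
      rw [hℓ]
      have e : P + R - (r : ℝ) = R - ((r : ℝ) - P) := by ring
      rw [e, abs_sub_comm R ((r : ℝ) - P)]
      have h1 := abs_sub_abs_le_abs_sub ((r : ℝ) - P) R
      rw [abs_of_pos hRpos] at h1
      exact h1
    refine le_trans ?_ htri
    have hqD2 : 1 / (q : ℝ) ^ (k + 2) / 2 ≤ 1 / (q * D) / 2 := by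
      have h1 : (q : ℝ) * D ≤ (q : ℝ) ^ (k + 2) := by
        rw [pow_succ']; exact mul_le_mul_of_nonneg_left hDq hq0R.le
      have h2 : 1 / (q : ℝ) ^ (k + 2) ≤ 1 / (q * D) := one_div_le_one_div_of_le (by positivity) h1
      linarith
    have hmain : Real.exp (-(8 * L * LL)) ≤ 1 / (q : ℝ) ^ (k + 2) / 2 := by
      have h3 : 1 / (q : ℝ) ^ (k + 2) = Real.exp (-(((k : ℝ) + 2) * L)) := by
        rw [hqpow, one_div, ← Real.exp_neg]; push_cast; ring_nf
      have hLLL : 1 ≤ 2 * L * LL := by nlinarith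
      have h2 : (2 : ℝ) ≤ Real.exp (2 * L * LL) := by linarith [Real.add_one_le_exp (2 * L * LL)]
      have hE : ((k : ℝ) + 2) * L ≤ 6 * L * LL := by nlinarith
      have h1 : Real.exp (-(8 * L * LL)) * 2 ≤ Real.exp (-(((k : ℝ) + 2) * L)) :=
        calc Real.exp (-(8 * L * LL)) * 2 ≤ Real.exp (-(8 * L * LL)) * Real.exp (2 * L * LL) :=
              mul_le_mul_of_nonneg_left h2 (Real.exp_pos _).le
          _ = Real.exp (-(6 * L * LL)) := by rw [← Real.exp_add]; ring_nf
          _ ≤ Real.exp (-(((k : ℝ) + 2) * L)) := Real.exp_le_exp.mpr (by linarith)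
      rw [h3]
      linarith
    linarith

/-- **`ℓ_b` is NOT log-log-Liouville** (`b ≥ 2`; hypothesis-free): Liouville's numbers sit BELOW the log-log floor of
the g35 cell (their own order at denominator `q = b^{N!}` is `q^{−(N+1)}`, `N ≍ log log q / log log log q`). With the
cell's `Set.range` equality this puts the wall cell `(1, ℓ₂, ℓ₃)` outside every g34/g35 cell. -/
theorem not_logLogLiouville_liouvilleNumber {b : ℕ} (hb : 2 ≤ b) :
    ¬ LogLogLiouville (liouvilleNumber b) := by
  intro hH
  obtain ⟨r, hden, -, hlt⟩ := hH (b + 100)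
  have hqb : b ≤ r.den := by omega
  have hq100 : 100 ≤ r.den := by omega
  have hlow := liouvilleNumber_sub_rat_lower_loglog hb r hqb hq100
  have hq0R : (0 : ℝ) < r.den := by exact_mod_cast r.den_pos
  have hL1 : 1 ≤ Real.log r.den :=
    (Real.le_log_iff_exp_le hq0R).mpr (exp_one_le_four.trans (by exact_mod_cast (show 4 ≤ r.den by omega)))
  have hLL0 : 0 ≤ Real.log (Real.log r.den) := Real.log_nonneg hL1
  have hprod : 0 ≤ Real.log r.den * Real.log (Real.log r.den) := mul_nonneg (by linarith) hLL0
  have h1 : Real.exp (-(((b + 100 : ℕ) : ℝ) * Real.log r.den * Real.log (Real.log r.den))) ≤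
      Real.exp (-(8 * Real.log r.den * Real.log (Real.log r.den))) := by
    rw [Real.exp_le_exp, neg_le_neg_iff, mul_assoc, mul_assoc]
    refine mul_le_mul_of_nonneg_right ?_ hprod
    push_cast; linarith [(Nat.cast_nonneg b : (0 : ℝ) ≤ b)]
  linarith

/-- `ℓ₃ < 1 < ℓ₂` (numerics for the range bookkeeping). -/
theorem liouvilleNumber_three_lt_one : liouvilleNumber 3 < 1 := by
  have h := partialSum_add_remainder (by norm_num : (1 : ℝ) < 3) 1
  have hp : partialSum 3 1 = 2 / 3 := by
    simp [partialSum, Finset.sum_range_succ]; norm_num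
  have hr : remainder 3 1 ≤ 2 / 3 ^ (1 + 1)! := remainder_le (by norm_num) 1
  norm_num at hr
  linarith

/-- `1 < ℓ₂` (Mathlib's `liouvilleNumber 2 = Σ_{i ≥ 0} 2^{-i!} = 1/2 + 1/2 + 1/4 + 1/64 + …`). -/
private theorem one_lt_liouvilleNumber_two : 1 < liouvilleNumber 2 := by
  have h := partialSum_add_remainder (by norm_num : (1 : ℝ) < 2) 1
  have hp : partialSum 2 1 = 1 := by
    simp [partialSum, Finset.sum_range_succ]; norm_num
  have hr := remainder_pos (by norm_num : (1 : ℝ) < 2) 1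
  linarith

end FormBound

end Summit.Schanuel.Schanuel.Theorems.RootDecomp1KTwoBaseCell
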